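import Summits.BirchSwinnertonDyer.Rank1Residual.X11a.SelmerCompanionStrictPlaces
import Summits.BirchSwinnertonDyer.Rank1Residual.X11a.SelmerCompanionRoute
import Summits.BirchSwinnertonDyer.Rank1Residual.X11b.KummerLocalIndex
import HarnessLib

/-!
# Route (3e) SELMER COMPANION, XXII: the strictness certificate of a closed rank-one partner AWAY
# from `p` (shapes D and mirror-D), in the kernel (class X11a = N7; cell `b2b-bsdres`, unit
# `b2b-bsdres-x11a`, gen 29)

HONEST FRAMING (run/shared/lean/b2b/bsd-rank1-residual/, verbatim in every file): the goal of the
cell is to DELETE the COMBINATION-SHAPED residual classes of the Birch–Swinnerton-Dyer formula for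
ALL analytic-rank `≤ 1` elliptic curves over `ℚ` — "full BSD formula for every rank `≤ 1` curve in
class `C`" assembled STRICTLY from published theorems — so that the rank-`≤ 1` remainder becomes
exactly the CONSTRUCTION-SHAPED classes, which are TYPED (missing-input `Prop`s), NOT attempted.
This is not "finishing BSD". CLASS-OWNERS.md: research routes; NO CLAIM BEYOND STATED CLASSES.
THEOREMS ONLY; nothing booked; no label moves. CONDITIONAL on the PUBLISHED binders GZK (`hGZK`),
Cassels–Tate (`hCT`), Tate uniformisation (`hU` = A40, `hU2` = A41), Tate's local Euler
characteristic (`hEP`, Milne *ADT* I Thm. 2.8), and on the per-pair finite data named.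

## What this file proves

Shapes D (file XV) and mirror-D (file XVI) remove the factor `#Sel^(p)(A)` under the hypothesis
`hstrict`: `Sel^(p)(A/ℚ) → H¹(L, A[p])` is injective at the strict place `L = ℚ_{ℓ₀}`. The census
certifies it for a CLOSED rank-one partner by the finite check that Cremona's generator `g` is not
`p`-divisible in `A(ℚ_{ℓ₀})` (`A` good at `ℓ₀`: `g̃ ∉ p·Ã(𝔽_{ℓ₀})`; `A` split at `ℓ₀`: the point
`(n/p)·g` reduces to the node). This file puts the link in the kernel:

* `res_kummerMapTorsion_ne_zero_of_not_zsmul` — if the image of `g` in `(A⁄L)(L)` is not `p`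
  times an `L`-rational point, the Kummer class `κ(g)` restricts NON-trivially to `H¹(L, A[p])`
  (tree: `res_L κ(g) = κ_L(g_L)`, `X11b/KummerLocalIndex`, and `ker κ_L = p·(A⁄L)(L)`,
  `ker_localKummerMap`);
* `strict_away_of_generator_certificate` — with `#Sel^(p)(A/ℚ) = p` this gives `hstrict`
  (file XVI `strict_of_natCard_selmerGroup_eq_prime`; `κ(g) ∈ Sel^(p)(A)` by
  `kummerMapTorsion_mem_selmerLocalKer`);
* `bsdp_of_bsdp_partner_of_generator_certificate_away` — the booking shape
  `bsdp_of_selmerCompanion_kill_six_kinds` (file XVI: strict place described by `hkill`, supplied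
  by file XIV at a split level-lowering place of `E` or by the mirror lemma) with `hstrict`
  REPLACED by: `BSD(A,p)`, `r_an(A) = 1`, `p ∤ #Ш_an(A)`, `A[p]` irreducible (so
  `#Sel^(p)(A) = p`, file II) and a rational point `g` of `A` not `p`-divisible in `(A⁄ℚ_{ℓ₀})(ℚ_{ℓ₀})`.
  What remains outside the kernel is only the reading of '`g ∉ p·A(ℚ_{ℓ₀})`' from the residue
  field (reduction is a homomorphism on `ℚ_{ℓ₀}`-points: `g = pR ⟹ g̃ = p·R̃`).

References: files II, XIV–XVI; [SilvermanAEC2009] VIII.§2, X.§4; [MazurRubin2004] §2.3;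
HOME/b2b-bsdres-x11a/REPORT-g29.md.
-/

set_option autoImplicit false

noncomputable section

open scoped Classical NNReal

open WeierstrassCurve Literature.NumberTheory.EllipticCurves
  Literature.NumberTheory.GaloisRepresentations Field NumberField IsDedekindDomain
  Literature.NumberTheory.EllipticCurves.Rank1Residual
  Literature.NumberTheory.EllipticCurves.Rank1Residual.Typed

namespace Summit.BirchSwinnertonDyer.Rank1Residual.X11a.SelmerCompanion

section Local

variable (A : WeierstrassCurve ℚ) [A.IsElliptic] (p : ℕ) [hp : Fact p.Prime]
  (L : Type) [Field L] [Algebra ℚ L]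

/-- **A point not `p`-divisible over `L` has a Kummer class restricting non-trivially to `L`.**
For a `ℚ`-field `L` of characteristic `0` (an explicit hypothesis `hL`, to keep the completion's
own `ℚ`-algebra structure at the call site), `g ∈ A(ℚ)` and the tree's Kummer map `κ`:
`res_L κ(g) = κ_L(g_L)` (`res_kummerMapTorsion_eq_localKummerMap`) and `ker κ_L = p·(A⁄L)(L)`
(`ker_localKummerMap`), so `g_L ∉ p·(A⁄L)(L)` forces `res_L κ(g) ≠ 0`.
[cite: SilvermanAEC2009, VIII.§2 and X.§4 diagram (**)] -/
theorem res_kummerMapTorsion_ne_zero_of_not_zsmul (hL : CharZero L)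
    (hdiv : ∀ P : geomPoints A, ∃ Q : geomPoints A, (p : ℤ) • Q = P) (g : A.toAffine.Point)
    (hcert : ∀ R : (A.baseChange L).toAffine.Point,
      Affine.Point.baseChange (W' := A) ℚ L g ≠ (p : ℤ) • R) :
    galoisCohomology.res (A.torsionGaloisModule (p : ℤ)) L 1 (kummerMapTorsion A (p : ℤ) hdiv g)
      ≠ 0 := by
  haveI := hL
  have hn : (p : ℤ) ≠ 0 := by exact_mod_cast hp.out.ne_zero
  intro h0
  rw [X11b.KummerIndex.res_kummerMapTorsion_eq_localKummerMap A L hn hdiv g] at h0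
  have hker : Affine.Point.baseChange (W' := A) ℚ L g ∈ (A.localKummerMap L hn).ker := h0
  rw [A.ker_localKummerMap L hn] at hker
  obtain ⟨R, hR⟩ := hker
  exact hcert R (by rw [← hR]; rfl)

/-- **The strictness certificate away from `p`.** If `#Sel^(p)(A/ℚ) = p` and a rational point `g`
of `A` is not `p`-divisible in `(A⁄L)(L)`, then `Sel^(p)(A/ℚ) → H¹(L, A[p])` is injective (the
hypothesis `hstrict` of files XV/XVI): `κ(g) ∈ Sel^(p)(A)` (`kummerMapTorsion_mem_selmerLocalKer` at
every place) restricts non-trivially, and a group of prime order is generated by any non-zero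
element (file XVI `strict_of_natCard_selmerGroup_eq_prime`). [cite: MazurRubin2004, §2.3]
[cite: SilvermanAEC2009, X.§4 diagram (**), Thm X.4.2] -/
theorem strict_away_of_generator_certificate (hL : CharZero L)
    (hSel : Nat.card (A.selmerGroup (p : ℤ)) = p)
    (hdiv : ∀ P : geomPoints A, ∃ Q : geomPoints A, (p : ℤ) • Q = P) (g : A.toAffine.Point)
    (hcert : ∀ R : (A.baseChange L).toAffine.Point,
      Affine.Point.baseChange (W' := A) ℚ L g ≠ (p : ℤ) • R)
    {d : galH1Torsion A (p : ℤ)} (hd : d ∈ A.selmerGroup (p : ℤ))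
    (hd0 : galoisCohomology.res (A.torsionGaloisModule (p : ℤ)) L 1 d = 0) : d = 0 := by
  have hs : kummerMapTorsion A (p : ℤ) hdiv g ∈ A.selmerGroup (p : ℤ) :=
    (mem_selmerGroup_iff A _ _).mpr
      ⟨fun v ↦ kummerMapTorsion_mem_selmerLocalKer A (p : ℤ) hdiv (v.adicCompletion ℚ) g,
        fun w' ↦ kummerMapTorsion_mem_selmerLocalKer A (p : ℤ) hdiv w'.Completion g⟩
  exact strict_of_natCard_selmerGroup_eq_prime A L hSel hs
    (res_kummerMapTorsion_ne_zero_of_not_zsmul A p L hL hdiv g hcert) hd hd0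

end Local

section Rat

variable (W A : WeierstrassCurve ℚ) [W.IsElliptic] [W.IsGloballyMinimal] [A.IsElliptic]
  [A.IsGloballyMinimal] (p : ℕ) [hp : Fact p.Prime]

/-- **Shapes D / mirror-D with the generator certificate — `BSD(A,p) ⟹ BSD(E,p)`.** As
`bsdp_of_selmerCompanion_kill_six_kinds` (file XVI: the strict place `v₀` enters only through
`hkill`, supplied by file XIV at a SPLIT multiplicative level-lowering place `ℓ₀ ∤ p`, `p ∤ ℓ₀ − 1`, of
`E` where `A` is good, or by `res_h1Equiv_eq_zero_of_good_of_split` at a place where `E` is good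
and `A` split), with the injectivity `hstrict` REPLACED by its certificate: `A` CLOSED at `p`
(`BSD(A,p)`), `r_an(A) = 1`, `p ∤ #Ш_an(A)`, `A[p]` irreducible — so `#Sel^(p)(A/ℚ) = p` (file II) —
and a rational point `g ∈ A(ℚ)` not `p`-divisible in `(A⁄ℚ_{v₀})(ℚ_{v₀})` (`hcert`; census reading:
`g̃ ∉ p·Ã(𝔽_{ℓ₀})` when `A` is good at `ℓ₀`, '`(n/p)·g` reduces to the node' when `A` is split).
The Kummer class uses the tree's `kummerMapTorsion` with the divisibility theorem
`zsmul_geomPoints_surjective_of_charZero`; the characteristic-zero instance of `ℚ_{v₀}` is passed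
explicitly (`charZero_adicCompletion`). Binders GZK, Cassels–Tate, A40/A41, Milne I.2.8. Not a class
theorem; nothing booked. [cite: Miller2011LMS, §1 and Def. 1.1] [cite: MazurRubin2004, §2.3]
[cite: SilvermanAEC2009, VIII.§2, X.§4 diagram (**), Thm X.4.2]
[cite: SilvermanATAEC1994, Ch. V Thm. 3.1, Lemma 5.2, Thm. 5.3, Cor. 5.4, Ex. 5.11]
[cite: GreenbergLNM1716, §2 Props. 2.2, 2.4] [cite: MilneADT2006, Ch. I §2 Thm. 2.8, Prop. 3.8] -/
theorem bsdp_of_bsdp_partner_of_generator_certificate_away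
    (hU : Silverman1994_thmV53_tateUniformisation.{0})
    (hU2 : Silverman1994_thmV53_corV54_tateUniformisation.{0})
    (hEP : ∀ v : HeightOneSpectrum (𝓞 ℚ), (p : 𝓞 ℚ) ∈ v.asIdeal →
      localEulerPoincareCharacteristic (v.adicCompletion ℚ))
    (hGZK : rank_eq_analyticRank_of_analyticRank_le_one)
    (hCT : exists_casselsTate_pairing (K := ℚ)) (hp2 : p ≠ 2)
    (hr : W.analyticRank = 0) (hirr : Irr W p) (hSha : X11a.ShaAnUnit W p)
    (hbsdA : BSDp A p) (hrA : A.analyticRank = 1) (hirrA : Irr A p) (hShaA : X11a.ShaAnUnit A p)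
    (θ : geomTorsion W (p : ℤ) ≃+ geomTorsion A (p : ℤ))
    (hθ : ∀ (σ : absoluteGaloisGroup ℚ) (P : geomTorsion W (p : ℤ)), θ (σ • P) = σ • θ P)
    (S T : Finset (HeightOneSpectrum (𝓞 ℚ))) (hTS : T ⊆ S)
    (hS : ∀ v : HeightOneSpectrum (𝓞 ℚ), v ∉ S →
      A.HasGoodReductionAt v ∧ W.HasGoodReductionAt v ∧ (p : 𝓞 ℚ) ∉ v.asIdeal)
    (hplaces : ∀ v ∈ S, v ∉ T →
      ((p : 𝓞 ℚ) ∉ v.asIdeal ∧ Nat.card (nsmulAddMonoidHom p :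
          (W.baseChange (v.adicCompletion ℚ)).toAffine.Point →+ _).ker = 1) ∨
      (A.HasSplitMultiplicativeReductionAt v ∧ W.HasSplitMultiplicativeReductionAt v ∧
        Nat.card (nsmulAddMonoidHom p :
          (A.baseChange (v.adicCompletion ℚ)).toAffine.Point →+ _).ker ≤ p) ∨
      (A.HasMultiplicativeReductionAt v ∧ W.HasMultiplicativeReductionAt v ∧
        (∃ r : v.adicCompletion ℚ, algebraMap ℚ (v.adicCompletion ℚ) (-(A.c₄ / A.c₆)) =
          r ^ 2 * algebraMap ℚ (v.adicCompletion ℚ) (-(W.c₄ / W.c₆))) ∧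
        (∀ ζ : v.adicCompletion ℚ, ζ ^ p = 1 → ζ = 1)) ∨
      (∃ (ℓ : ℕ) (_ : Fact ℓ.Prime), ℓ ≠ 2 ∧ (ℓ : 𝓞 ℚ) ∈ v.asIdeal ∧ (p : 𝓞 ℚ) ∉ v.asIdeal ∧
        W.HasMultiplicativeReductionAtPrime ℓ ∧
        (∀ r : v.adicCompletion ℚ, algebraMap ℚ (v.adicCompletion ℚ) (-(W.c₄ / W.c₆)) ≠ r ^ 2) ∧
        A.HasGoodReductionAt v) ∨
      ((p : 𝓞 ℚ) ∈ v.asIdeal ∧ W.HasMultiplicativeReductionAtPrime p ∧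
        (∀ r : v.adicCompletion ℚ, algebraMap ℚ (v.adicCompletion ℚ) (-(W.c₄ / W.c₆)) ≠ r ^ 2) ∧
        A.HasGoodReductionAtPrime p) ∨
      (∃ (ℓ : ℕ) (_ : Fact ℓ.Prime), ℓ ≠ 2 ∧ (ℓ : 𝓞 ℚ) ∈ v.asIdeal ∧ (p : 𝓞 ℚ) ∉ v.asIdeal ∧
        W.HasGoodReductionAt v ∧ A.HasMultiplicativeReductionAtPrime ℓ ∧
        (∀ r : v.adicCompletion ℚ, algebraMap ℚ (v.adicCompletion ℚ) (-(A.c₄ / A.c₆)) ≠ r ^ 2)))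
    {v₀ : HeightOneSpectrum (𝓞 ℚ)}
    (hkill : ∀ c ∈ selmerLocalKer W (v₀.adicCompletion ℚ) (p : ℤ),
      h1Equiv θ hθ c ∈ selmerLocalKer A (v₀.adicCompletion ℚ) (p : ℤ) →
      galoisCohomology.res (A.torsionGaloisModule (p : ℤ)) (v₀.adicCompletion ℚ) 1
        (h1Equiv θ hθ c) = 0)
    (g : A.toAffine.Point)
    (hcert : ∀ R : (A.baseChange (v₀.adicCompletion ℚ)).toAffine.Point,
      Affine.Point.baseChange (W' := A) ℚ (v₀.adicCompletion ℚ) g ≠ (p : ℤ) • R)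
    (hbudget : ∏ v ∈ T, (Nat.card (nsmulAddMonoidHom p :
        (W.baseChange (v.adicCompletion ℚ)).toAffine.Point →+ _).ker *
          Nat.card (v.adicCompletionIntegers ℚ ⧸
            Ideal.span {(p : v.adicCompletionIntegers ℚ)})) ≤ p) :
    BSDp W p := by
  have hpp : p.Prime := hp.out
  have hn : (p : ℤ) ≠ 0 := by exact_mod_cast hpp.ne_zero
  have hSel : Nat.card (A.selmerGroup (p : ℤ)) = p := by
    rw [natCard_selmerGroup_eq_pow_of_bsdp A p hbsdA hShaA hirrA, hrA, pow_one]
  have hdiv : ∀ P : geomPoints A, ∃ Q : geomPoints A, (p : ℤ) • Q = P :=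
    fun P ↦ A.zsmul_geomPoints_surjective_of_charZero hn P
  exact bsdp_of_selmerCompanion_kill_six_kinds W A p hU hU2 hEP hGZK hCT hp2 hr hirr hSha θ hθ S T
    hTS hS hplaces hkill
    (fun d hd hd0 ↦ strict_away_of_generator_certificate A p (v₀.adicCompletion ℚ)
      (charZero_adicCompletion v₀) hSel hdiv g hcert hd hd0) hbudget

end Rat

end Summit.BirchSwinnertonDyer.Rank1Residual.X11a.SelmerCompanion

end
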